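import Literature.Computability.AlgebraicComplexity.DeterminantalComplexityProofs
import Literature.Computability.AlgebraicComplexity.StandardFamiliesProofs
import Literature.Barriers.ValiantsHypothesis.GCTMatrixPoweringGrenet
import Summits.ValiantsHypothesis.ValiantsHypothesis.Theorems.DetQPDetqpSuperquadraticStubVertexGauge
import Summits.ValiantsHypothesis.ValiantsHypothesis.Theorems.DetQPDetqpSuperquadraticStubKrylovIdentities
import Summits.ValiantsHypothesis.ValiantsHypothesis.Theorems.DetQPDetqpSuperquadraticStubTraceUnrolling

/-!
# Crux `DetQP.DetqpSuperquadratic` (stmt-ValiantsHypothesis-0318), line `linear-homogenisation-transfer` —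
consequences of the landed stubs: linear homogenisation `pc(per_n) + 1 ≤ 2·dc(per_n)`

From the landed stubs S1a (`stub_vertexGauge`), S1b (`stub_krylovIdentities`) and S2 (`stub_traceUnrolling`)
of `Theorems/DetQPDetqpSuperquadraticStub*.lean`:

* `hasKrylov_of_hasDetRepr_perPoly` — every affine determinantal expression of `per_n` (`n ≥ 3`) of size
  `w + 1` yields a Krylov normal form of width `w` (homogeneous linear `ρ, γ, L` with
  `ρᵀ L^(n−2) γ = per_n`, `ρᵀ Lʲ γ = 0` for `j < n − 2`, `per_n ∣ ρᵀ Lʲ γ` for all `j`);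
* `hasPowTraceRepr_of_hasDetRepr_perPoly` — … and hence a power-trace expression `per_n = tr(𝕄ⁿ)` of
  size `2w + 1`;
* `powTraceComplexity_add_one_le_two_mul_dc_perPoly` — **linear homogenisation**:
  `pc(per_n) + 1 ≤ 2·dc(per_n)` for `n ≥ 3` (the affine determinantal and the homogeneous matrix-powering
  model agree up to a factor `2` for the permanent; Ikenmeyer–Landsberg 2017 Thm 4.1/Rem 4.2 had only the
  cubic dictionary `pc ≤ dc³/3`-type bounds through Mahajan–Vinay).
-/

noncomputable section

-- `Summit.ValiantsHypothesis.ValiantsHypothesis.…` is the tree's mandated single-conjunct layout (Sub = Summit).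
set_option linter.dupNamespace false

namespace Summit.ValiantsHypothesis.ValiantsHypothesis.Theorems.DetQPDetqpSuperquadratic

open MvPolynomial Matrix
open Literature.Computability.AlgebraicComplexity
open Literature.Barriers.ValiantsHypothesis (HasPowTraceRepr powTraceComplexity)

/-- `per_n` is homogeneous of degree `n`. [folklore] -/
theorem perPoly_isHomogeneous_fin (n : ℕ) : (perPoly (Fin n) ℂ).IsHomogeneous n := by
  simpa [Fintype.card_fin] using (perPoly_isHomogeneous (n := Fin n) (k := ℂ))

/-- **Determinantal expressions yield Krylov normal forms** (S1a + S1b): every affine determinantal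
expression of `per_n` (`n ≥ 3`) of size `w + 1` gives homogeneous linear `ρ, γ, L` of width `w` with
`ρᵀ L^(n−2) γ = per_n`, `ρᵀ Lʲ γ = 0` for `j < n − 2` and `per_n ∣ ρᵀ Lʲ γ` for all `j`
(Chatterjee–Kumar–Volk 2024 Thm 13 for the permanent, plus the divisibility). [folklore] -/
theorem hasKrylov_of_hasDetRepr_perPoly {n w : ℕ} (hn : 3 ≤ n)
    (h : HasDetRepr (perPoly (Fin n) ℂ) (w + 1)) :
    ∃ (ρ γ : Fin w → MvPolynomial (Fin n × Fin n) ℂ)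
      (L : Matrix (Fin w) (Fin w) (MvPolynomial (Fin n × Fin n) ℂ)),
      (∀ i, (ρ i).IsHomogeneous 1) ∧ (∀ i, (γ i).IsHomogeneous 1) ∧
      (∀ i j, (L i j).IsHomogeneous 1) ∧
      ρ ⬝ᵥ ((L ^ (n - 2)) *ᵥ γ) = perPoly (Fin n) ℂ ∧
      (∀ j : ℕ, j < n - 2 → ρ ⬝ᵥ ((L ^ j) *ᵥ γ) = 0) ∧
      (∀ j : ℕ, perPoly (Fin n) ℂ ∣ ρ ⬝ᵥ ((L ^ j) *ᵥ γ)) := by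
  obtain ⟨ρ, γ, L, hρ, hγ, hL, hadj⟩ := stub_vertexGauge n hn w h
  obtain ⟨hA3, hA2, hA4⟩ := stub_krylovIdentities ℂ (Fin n × Fin n) n w (perPoly (Fin n) ℂ) ρ γ L
    (by omega) (perPoly_isHomogeneous_fin n) hρ hγ hL hadj
  refine ⟨ρ, γ, -L, hρ, hγ, fun i j => ?_, hA3, hA2, hA4⟩
  rw [Matrix.neg_apply]
  exact (hL i j).neg

/-- **Every determinantal expression of `per_n` is, losslessly, a power-trace expression of twice the
size** (S1a + S1b + S2): `HasDetRepr per_n (w + 1) → HasPowTraceRepr ℂ per_n n (2w + 1)` for `n ≥ 3`.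
[folklore] -/
theorem hasPowTraceRepr_of_hasDetRepr_perPoly {n w : ℕ} (hn : 3 ≤ n)
    (h : HasDetRepr (perPoly (Fin n) ℂ) (w + 1)) :
    HasPowTraceRepr ℂ (perPoly (Fin n) ℂ) n (2 * w + 1) := by
  obtain ⟨ρ, γ, L, hρ, hγ, hL, hA3, hA2, -⟩ := hasKrylov_of_hasDetRepr_perPoly hn h
  exact stub_traceUnrolling (Fin n × Fin n) n w (perPoly (Fin n) ℂ) ρ γ L (by omega) hρ hγ hL hA3 hA2

/-- `dc(per_n) ≥ 1` for `n ≥ 1` (`dc ≥ totalDegree = n`). [folklore] -/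
theorem one_le_determinantalComplexity_perPoly {n : ℕ} (hn : 1 ≤ n) :
    1 ≤ determinantalComplexity (perPoly (Fin n) ℂ) := by
  have h1 : (perPoly (Fin n) ℂ).totalDegree ≤ determinantalComplexity (perPoly (Fin n) ℂ) :=
    totalDegree_le_determinantalComplexity_holds _
  have h2 : (perPoly (Fin n) ℂ).totalDegree = Fintype.card (Fin n) := totalDegree_perPoly_holds
  rw [Fintype.card_fin] at h2
  omega

/-- **Registered sub-goal `stub_linearHomogenisation` — linear homogenisation**
`pc(per_n) + 1 ≤ 2·dc(per_n)` for `n ≥ 3`: the attained determinantal complexity `dc(per_n) = w + 1`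
(`hasDetRepr_determinantalComplexity_holds`) yields a power-trace expression of size `2w + 1`.  The affine
determinantal model and the homogeneous matrix-powering model of Gesmundo–Ikenmeyer–Panova 2017 therefore
agree up to a factor `2` for the permanent (previously only a cubic dictionary was available:
Ikenmeyer–Landsberg 2017, Thm 4.1 / Rem 4.2). [folklore] -/
theorem stub_linearHomogenisation :
    ∀ n : ℕ, 3 ≤ n → powTraceComplexity ℂ (perPoly (Fin n) ℂ) n + 1 ≤
      2 * determinantalComplexity (perPoly (Fin n) ℂ) := by
  intro n hn
  have hatt : HasDetRepr (perPoly (Fin n) ℂ) (determinantalComplexity (perPoly (Fin n) ℂ)) :=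
    hasDetRepr_determinantalComplexity_holds _
  have hpos : 1 ≤ determinantalComplexity (perPoly (Fin n) ℂ) :=
    one_le_determinantalComplexity_perPoly (by omega)
  obtain ⟨w, hw⟩ : ∃ w : ℕ, determinantalComplexity (perPoly (Fin n) ℂ) = w + 1 :=
    ⟨determinantalComplexity (perPoly (Fin n) ℂ) - 1, by omega⟩
  rw [hw] at hatt ⊢
  have hT := hasPowTraceRepr_of_hasDetRepr_perPoly hn hatt
  have hpc : powTraceComplexity ℂ (perPoly (Fin n) ℂ) n ≤ 2 * w + 1 := Nat.sInf_le hT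
  omega

/-- **Linear homogenisation**, named form: `pc(per_n) + 1 ≤ 2·dc(per_n)` for `n ≥ 3`
(`stub_linearHomogenisation`). [folklore] -/
theorem powTraceComplexity_add_one_le_two_mul_dc_perPoly {n : ℕ} (hn : 3 ≤ n) :
    powTraceComplexity ℂ (perPoly (Fin n) ℂ) n + 1 ≤ 2 * determinantalComplexity (perPoly (Fin n) ℂ) :=
  stub_linearHomogenisation n hn

end Summit.ValiantsHypothesis.ValiantsHypothesis.Theorems.DetQPDetqpSuperquadratic
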